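import Summits.RiemannHypothesis.RiemannHypothesis.Theorems.GroundBartaPolarPerronFrobeniusSignImproving
import Summits.RiemannHypothesis.RiemannHypothesis.Theorems.GroundBartaPolarPerronFrobeniusConeMinimizingSeq
import Summits.RiemannHypothesis.RiemannHypothesis.Theorems.GroundBartaPolarPerronFrobeniusAeNonnegOfL2Limit
import Summits.RiemannHypothesis.RiemannHypothesis.Theorems.GroundBartaPolarPerronFrobeniusEvenNormalForm
import Summits.RiemannHypothesis.RiemannHypothesis.Theorems.OddSectorOddOneSignedWindowsRealPart
import Literature.NumberTheory.LFunctions.WeilSemilocalCompactnessProofs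
import HarnessLib

/-!
# RiemannHypothesis / GroundBarta — crux `PolarPerronFrobenius` (stmt-RiemannHypothesis-18390):
# PERRON–FROBENIUS AT SMALL WINDOWS — cone density and a non-negative ground state of the FULL
# windowed Weil form at every window `0 < a ≤ 1/10` (part 3/3, RH-free)

Helper file (`--supports`), RH-free, Mathlib + proved tree files only, no definitions.

The crux `PolarPerronFrobenius` asks, beyond every height, for a window at which an even-winning
bottom forces a ground state of the full windowed Weil form that is real and `≥ 0` a.e. (`GSP a`); the
refuter's attack (Cruxes/PolarPerronFrobenius/CruxAttack-r1.md, F3/F6) records that `GSP a` had no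
inhabitant at ANY window, in Lean or in print (Suzuki 2026 Thm 1.4: simple + even at small windows; no
sign), and that no soft Perron–Frobenius mechanism survives the rank-one polar term.  This file proves
that it DOES survive at small windows, by the sign-improving inequality of part 2
(`sw_exists_nonneg_test_lt`: the Beurling–Deny gain of the Markov part beats the polar loss while
`2 cosh a ≤ w(2a)`, in particular for `a ≤ 1/10`):

* `sw_coneDense_small` — **cone density**: for `0 < a ≤ 1/10`, every `L²`-normalised window test is
  matched up to any `δ > 0` by a normalised NON-NEGATIVE real window test (the hypothesis of the landed
  stub `stub_coneMinimizingSeq`); `sw_evenConeDense_small` — the same inside the even sector, i.e. the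
  matrix of the registered RH-bearing stub `stub_evenConeDense_cofinal` holds UNCONDITIONALLY (no
  even-winning hypothesis) at every window `a ≤ 1/10`;
* `sw_exists_nonneg_isWeilGroundState` — **`GSP a` for `0 < a ≤ 1/10`**: the full windowed Weil form
  has a ground state (`IsWeilGroundState a u`, Bombieri's Problem 2) that is real and `≥ 0` a.e.
  (cone density + `stub_coneMinimizingSeq` + CCM25 Thm 3.6 compactness + `stub_aeNonneg_of_L2_limit`);
  `sw_exists_even_real_nonneg_isWeilGroundState` — indeed one that is even, real-valued and `≥ 0`
  everywhere; `sw_GSP_small` — the same in the route items' inline (junk-free) encoding, so the matrix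
  `EW a → GSP a` of the crux holds at every small window (`sw_polarMatrix_small`).

So the RH-bearing content of the crux is confined to LARGE windows: the sign-improving mechanism is
sharp up to the pointwise kernel threshold `2cosh(r/2) ≤ w(r)` on `(0, 2a]` (`a ≤ 0.1406…`), beyond
which `Re Q(|g|) ≤ Re Q(g)` fails for suitable tests and one-signedness of the bottom must come from the
structure of near-minimisers (CruxAttack-r1 F6.3), not from a form inequality.
Prover B, speedrun unit `sr-gb-rung-b` (rung 3).

References: E. Bombieri, Rend. Lincei (9) 11 (2000) §4; A. Connes, C. Consani, H. Moscovici,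
arXiv:2511.22755 (2025) Thm 3.6; M. Suzuki, arXiv:2606.09096 (2026) Thm 1.4, §5.2.
-/

set_option linter.dupNamespace false

noncomputable section

open Set MeasureTheory Filter Complex
open scoped Real Topology

namespace Summit.RiemannHypothesis.RiemannHypothesis.Theorems.PolarPerronFrobenius

open Literature.NumberTheory.LFunctions
open Summit.RiemannHypothesis.RiemannHypothesis.Theorems.OddSector
open Summit.RiemannHypothesis.RiemannHypothesis.Theses.GroundBarta

/-! ## Real tests given through their complexification -/

section RealBridge

variable {f : ℝ → ℝ} {a : ℝ}

/-- Real smoothness from the complexified test property. [folklore] -/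
theorem sw_contDiff_of_isWeilTest_ofReal (hF : IsWeilTest fun t => ((f t : ℝ) : ℂ)) :
    ContDiff ℝ (⊤ : ℕ∞) f := by
  have h := Complex.reCLM.contDiff.comp hF.1
  have e : (Complex.reCLM ∘ fun t => ((f t : ℝ) : ℂ)) = f := by
    funext t
    simp
  rwa [e] at h

/-- Real compact support from the complexified test property. [folklore] -/
theorem sw_hasCompactSupport_of_isWeilTest_ofReal (hF : IsWeilTest fun t => ((f t : ℝ) : ℂ)) :
    HasCompactSupport f := by
  have h := hF.2.comp_left (g := Complex.re) Complex.zero_re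
  have e : (Complex.re ∘ fun t => ((f t : ℝ) : ℂ)) = f := by
    funext t
    simp
  rwa [e] at h

/-- **Real case, normalised.**  For `0 < a ≤ 1/10`, a real normalised window test `f` and `δ > 0`
there is a normalised NON-NEGATIVE real window test `w` with `Re Q(w) ≤ Re Q(f) + δ`, even if `f` is
even (normalise the approximant `ψ_η ∘ f` of `sw_exists_nonneg_test_lt`). [folklore] -/
theorem sw_cone_of_real (ha : 0 < a) (ha' : a ≤ 1 / 10) (hF : IsWeilTest fun t => ((f t : ℝ) : ℂ))
    (hsupp : tsupport (fun t => ((f t : ℝ) : ℂ)) ⊆ Icc (-a) a)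
    (hnorm : ∫ t, ‖((f t : ℝ) : ℂ)‖ ^ 2 = 1) {δ : ℝ} (hδ : 0 < δ) :
    ∃ w : ℝ → ℂ, IsWeilTest w ∧ tsupport w ⊆ Icc (-a) a ∧ (∀ t, (w t).im = 0 ∧ 0 ≤ (w t).re) ∧
      ∫ t, ‖w t‖ ^ 2 = 1 ∧
      (weilQuadratic w).re ≤ (weilQuadratic fun t => ((f t : ℝ) : ℂ)).re + δ ∧
      ((∀ t, f (-t) = f t) → ∀ t, w (-t) = w t) := by
  have hf := sw_contDiff_of_isWeilTest_ofReal hF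
  have hfs := sw_hasCompactSupport_of_isWeilTest_ofReal hF
  have hsuppR : tsupport f ⊆ Icc (-a) a := (sw_tsupport_ofReal_comp f) ▸ hsupp
  obtain ⟨η, hη, hNpos, hlt⟩ := sw_exists_nonneg_test_lt hf hfs ha ha' hsuppR hnorm hδ
  set W : ℝ → ℂ := fun t => ((Real.sqrt (f t ^ 2 + η ^ 2) - η : ℝ) : ℂ) with hWdef
  set N : ℝ := ∫ t, ‖W t‖ ^ 2 with hN
  have hW : IsWeilTest W := sw_isWeilTest_psi_comp hf hfs hη
  have hWs : tsupport W ⊆ Icc (-a) a := (sw_tsupport_psi_comp_subset hη.le).trans hsuppR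
  set c : ℝ := (Real.sqrt N)⁻¹ with hc
  have hcpos : 0 < c := inv_pos.2 (Real.sqrt_pos.2 hNpos)
  have hcc : c * c = 1 / N := by
    rw [hc, ← mul_inv, Real.mul_self_sqrt hNpos.le, one_div]
  refine ⟨fun t => (c : ℂ) * W t, hW.const_mul c, tsupport_mul_subset_right.trans hWs,
    fun t => ?_, ?_, ?_, fun hfe t => ?_⟩
  · simp only [hWdef, ← Complex.ofReal_mul, Complex.ofReal_im, Complex.ofReal_re]
    exact ⟨trivial, mul_nonneg hcpos.le (sw_psi_nonneg hη.le _)⟩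
  · simp only [norm_mul, mul_pow, Complex.norm_real, Real.norm_of_nonneg hcpos.le]
    rw [integral_const_mul, ← hN, hc, inv_pow, Real.sq_sqrt hNpos.le, inv_mul_cancel₀ hNpos.ne']
  · have hQ' : (weilQuadratic fun t => (c : ℂ) * W t).re = c * c * (weilQuadratic W).re := by
      rw [weilQuadratic_const_mul, Complex.normSq_ofReal, Complex.re_ofReal_mul]
    rw [hQ', hcc, one_div, inv_mul_eq_div, div_le_iff₀ hNpos]
    nlinarith [hlt]
  · simp only [hWdef]
    rw [hfe]

/-- **Real case, Rayleigh form.**  Same with `f` un-normalised: if `0 < ‖f‖₂²` and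
`Re Q(f) ≤ ‖f‖₂² · C`, the non-negative normalised test has `Re Q(w) ≤ C + δ`. [folklore] -/
theorem sw_cone_of_real' (ha : 0 < a) (ha' : a ≤ 1 / 10) (hF : IsWeilTest fun t => ((f t : ℝ) : ℂ))
    (hsupp : tsupport (fun t => ((f t : ℝ) : ℂ)) ⊆ Icc (-a) a)
    (hN : 0 < ∫ t, ‖((f t : ℝ) : ℂ)‖ ^ 2) {C : ℝ}
    (hQ : (weilQuadratic fun t => ((f t : ℝ) : ℂ)).re ≤ (∫ t, ‖((f t : ℝ) : ℂ)‖ ^ 2) * C)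
    {δ : ℝ} (hδ : 0 < δ) :
    ∃ w : ℝ → ℂ, IsWeilTest w ∧ tsupport w ⊆ Icc (-a) a ∧ (∀ t, (w t).im = 0 ∧ 0 ≤ (w t).re) ∧
      ∫ t, ‖w t‖ ^ 2 = 1 ∧ (weilQuadratic w).re ≤ C + δ ∧
      ((∀ t, f (-t) = f t) → ∀ t, w (-t) = w t) := by
  set N : ℝ := ∫ t, ‖((f t : ℝ) : ℂ)‖ ^ 2 with hNdef
  set c : ℝ := (Real.sqrt N)⁻¹ with hc
  have hcpos : 0 < c := inv_pos.2 (Real.sqrt_pos.2 hN)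
  have hcc : c * c = 1 / N := by
    rw [hc, ← mul_inv, Real.mul_self_sqrt hN.le, one_div]
  -- the normalised real function `c f`
  have e : (fun t => ((c * f t : ℝ) : ℂ)) = fun t => (c : ℂ) * ((f t : ℝ) : ℂ) := by
    funext t
    push_cast
    ring
  have hF1 : IsWeilTest fun t => ((c * f t : ℝ) : ℂ) := by
    rw [e]
    exact hF.const_mul c
  have hsupp1 : tsupport (fun t => ((c * f t : ℝ) : ℂ)) ⊆ Icc (-a) a := by
    rw [e]
    exact tsupport_mul_subset_right.trans hsupp
  have e' : ∀ t, ((c * f t : ℝ) : ℂ) = (c : ℂ) * ((f t : ℝ) : ℂ) := fun t => by push_cast; ring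
  have hnorm1 : ∫ t, ‖((c * f t : ℝ) : ℂ)‖ ^ 2 = 1 := by
    have h1 : ∀ t, ‖((c * f t : ℝ) : ℂ)‖ ^ 2 = c ^ 2 * ‖((f t : ℝ) : ℂ)‖ ^ 2 := fun t => by
      rw [e', norm_mul, mul_pow, Complex.norm_real, Real.norm_of_nonneg hcpos.le]
    simp only [h1]
    rw [integral_const_mul, ← hNdef, hc, inv_pow, Real.sq_sqrt hN.le, inv_mul_cancel₀ hN.ne']
  have hQ1 : (weilQuadratic fun t => ((c * f t : ℝ) : ℂ)).re ≤ C := by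
    rw [e, weilQuadratic_const_mul, Complex.normSq_ofReal, Complex.re_ofReal_mul, hcc, one_div,
      inv_mul_eq_div, div_le_iff₀ hN]
    linarith
  obtain ⟨w, hw, hws, hsign, hwn, hwQ, hwe⟩ := sw_cone_of_real ha ha' hF1 hsupp1 hnorm1 hδ
  refine ⟨w, hw, hws, hsign, hwn, by linarith, fun hfe => hwe fun t => ?_⟩
  rw [hfe]

end RealBridge

/-! ## Cone density at small windows -/

/-- Selection: of two non-negative weights summing to `1` carrying values summing to `c`, one weight
is positive and carries at most its share. [folklore] -/
theorem sw_select {x y p q c : ℝ} (hp : 0 ≤ p) (hq : 0 ≤ q) (hpq : p + q = 1) (hsum : x + y = c)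
    (hx0 : p = 0 → x = 0) (hy0 : q = 0 → y = 0) :
    (0 < p ∧ x ≤ p * c) ∨ (0 < q ∧ y ≤ q * c) := by
  by_cases hp0 : p = 0
  · right
    have hx := hx0 hp0
    refine ⟨by linarith, ?_⟩
    have hq1 : q = 1 := by linarith
    rw [hq1]
    linarith
  by_cases hq0 : q = 0
  · left
    have hy := hy0 hq0
    refine ⟨lt_of_le_of_ne hp (Ne.symm hp0), ?_⟩
    have hp1 : p = 1 := by linarith
    rw [hp1]
    linarith
  have hp' : 0 < p := lt_of_le_of_ne hp (Ne.symm hp0)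
  have hq' : 0 < q := lt_of_le_of_ne hq (Ne.symm hq0)
  by_cases hx : x ≤ p * c
  · exact Or.inl ⟨hp', hx⟩
  · right
    refine ⟨hq', ?_⟩
    have hqc : q * c = c - p * c := by rw [show q = 1 - p by linarith]; ring
    linarith [not_le.1 hx]

/-- **Cone density at small windows, with parity.**  For `0 < a ≤ 1/10`, every `L²`-normalised window
test `h` on `[-a, a]` is matched up to any `δ > 0` by an `L²`-normalised window test `w` that is
pointwise real and `≥ 0`, with `Re Q(w) ≤ Re Q(h) + δ`; `w` is even if `h` is even.  (Weil's
distribution is real: `Re Q(h) = Re Q(Re h) + Re Q(Im h)`, so one of the parts has Rayleigh quotient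
`≤ Re Q(h)`; then the real case.) [folklore] -/
theorem sw_coneDense_small_parity {a : ℝ} (ha : 0 < a) (ha' : a ≤ 1 / 10) {h : ℝ → ℂ}
    (hh : IsWeilTest h) (hsupp : tsupport h ⊆ Icc (-a) a) (hnorm : ∫ t, ‖h t‖ ^ 2 = 1)
    {δ : ℝ} (hδ : 0 < δ) :
    ∃ w : ℝ → ℂ, IsWeilTest w ∧ tsupport w ⊆ Icc (-a) a ∧ (∀ t, (w t).im = 0 ∧ 0 ≤ (w t).re) ∧
      ∫ t, ‖w t‖ ^ 2 = 1 ∧ (weilQuadratic w).re ≤ (weilQuadratic h).re + δ ∧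
      ((∀ t, h (-t) = h t) → ∀ t, w (-t) = w t) := by
  have hR : IsWeilTest fun t => (((h t).re : ℝ) : ℂ) := isWeilTest_rePart hh
  have hS : IsWeilTest fun t => (((h t).im : ℝ) : ℂ) := isWeilTest_imPart hh
  have hRs : tsupport (fun t => (((h t).re : ℝ) : ℂ)) ⊆ Icc (-a) a :=
    (tsupport_rePart_subset h).trans hsupp
  have hSs : tsupport (fun t => (((h t).im : ℝ) : ℂ)) ⊆ Icc (-a) a :=
    (tsupport_imPart_subset h).trans hsupp
  have hQ := re_weilQuadratic_eq_rePart_add_imPart hh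
  have hNRS : (∫ t, ‖(((h t).re : ℝ) : ℂ)‖ ^ 2) + ∫ t, ‖(((h t).im : ℝ) : ℂ)‖ ^ 2 = 1 := by
    rw [← hnorm]
    exact integral_norm_sq_rePart_add_imPart hh.memLp_two
  have hNR0 : 0 ≤ ∫ t, ‖(((h t).re : ℝ) : ℂ)‖ ^ 2 := integral_nonneg fun t => by positivity
  have hNS0 : 0 ≤ ∫ t, ‖(((h t).im : ℝ) : ℂ)‖ ^ 2 := integral_nonneg fun t => by positivity
  have hx0 : (∫ t, ‖(((h t).re : ℝ) : ℂ)‖ ^ 2) = 0 →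
      (weilQuadratic fun t => (((h t).re : ℝ) : ℂ)).re = 0 := fun h0 => by
    rw [hR.eq_zero_of_integral_norm_sq_eq_zero h0, weilQuadratic_zero, Complex.zero_re]
  have hy0 : (∫ t, ‖(((h t).im : ℝ) : ℂ)‖ ^ 2) = 0 →
      (weilQuadratic fun t => (((h t).im : ℝ) : ℂ)).re = 0 := fun h0 => by
    rw [hS.eq_zero_of_integral_norm_sq_eq_zero h0, weilQuadratic_zero, Complex.zero_re]
  rcases sw_select hNR0 hNS0 hNRS hQ.symm hx0 hy0 with ⟨hN, hle⟩ | ⟨hN, hle⟩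
  · obtain ⟨w, hw, hws, hsign, hwn, hwQ, hwe⟩ := sw_cone_of_real' ha ha' hR hRs hN hle hδ
    exact ⟨w, hw, hws, hsign, hwn, hwQ, fun hhe => hwe fun t => by rw [hhe]⟩
  · obtain ⟨w, hw, hws, hsign, hwn, hwQ, hwe⟩ := sw_cone_of_real' ha ha' hS hSs hN hle hδ
    exact ⟨w, hw, hws, hsign, hwn, hwQ, fun hhe => hwe fun t => by rw [hhe]⟩

/-- **Cone density at small windows** (the hypothesis of the landed stub `stub_coneMinimizingSeq`, at
every window `0 < a ≤ 1/10`): non-negative real window tests are energy-dense among all normalised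
window tests. [folklore] -/
theorem sw_coneDense_small {a : ℝ} (ha : 0 < a) (ha' : a ≤ 1 / 10) :
    ∀ h : ℝ → ℂ, IsWeilTest h → tsupport h ⊆ Set.Icc (-a) a → ∫ t, ‖h t‖ ^ 2 = (1 : ℝ) →
      ∀ δ : ℝ, 0 < δ →
        ∃ w : ℝ → ℂ, IsWeilTest w ∧ tsupport w ⊆ Set.Icc (-a) a ∧
          (∀ t, (w t).im = 0 ∧ 0 ≤ (w t).re) ∧ ∫ t, ‖w t‖ ^ 2 = (1 : ℝ) ∧
          (weilQuadratic w).re ≤ (weilQuadratic h).re + δ := by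
  intro h hh hsupp hnorm δ hδ
  obtain ⟨w, hw, hws, hsign, hwn, hwQ, -⟩ := sw_coneDense_small_parity ha ha' hh hsupp hnorm hδ
  exact ⟨w, hw, hws, hsign, hwn, hwQ⟩

/-- **Even cone density at small windows** — the matrix of the registered RH-bearing stub
`stub_evenConeDense_cofinal` (line `Sketch`) holds UNCONDITIONALLY at every window `0 < a ≤ 1/10`:
every even normalised window test is matched up to any `δ > 0` by an even CONE test (smooth, supported
in `[-a, a]`, even, pointwise real and `≥ 0`, normalised). [folklore] -/
theorem sw_evenConeDense_small {a : ℝ} (ha : 0 < a) (ha' : a ≤ 1 / 10) :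
    ∀ h : ℝ → ℂ, IsWeilTest h → tsupport h ⊆ Set.Icc (-a) a → (∀ t, h (-t) = h t) →
      ∫ t, ‖h t‖ ^ 2 = (1 : ℝ) → ∀ δ : ℝ, 0 < δ →
        ∃ w : ℝ → ℂ, IsWeilTest w ∧ tsupport w ⊆ Set.Icc (-a) a ∧ (∀ t, w (-t) = w t) ∧
          (∀ t, (w t).im = 0 ∧ 0 ≤ (w t).re) ∧ ∫ t, ‖w t‖ ^ 2 = (1 : ℝ) ∧
          (weilQuadratic w).re ≤ (weilQuadratic h).re + δ := by
  intro h hh hsupp hhe hnorm δ hδ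
  obtain ⟨w, hw, hws, hsign, hwn, hwQ, hwe⟩ := sw_coneDense_small_parity ha ha' hh hsupp hnorm hδ
  exact ⟨w, hw, hws, hwe hhe, hsign, hwn, hwQ⟩

/-! ## `GSP a` at every window `0 < a ≤ 1/10` -/

/-- **Perron–Frobenius at small windows.**  For every window `0 < a ≤ 1/10` the FULL windowed Weil
form has a ground state (operator-free: `IsWeilGroundState a u`, the `L²`-limit of a normalised
minimising sequence of window tests — Bombieri 2000 §4 Problem 2) that is real and `≥ 0` almost
everywhere.  Proof: cone density (`sw_coneDense_small`) ⇒ a normalised minimising sequence of cone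
tests (`stub_coneMinimizingSeq`, landed) ⇒ an `L²`-convergent subsequence by the compactness of the
semilocal Weil form (Connes–Consani–Moscovici 2025 Thm 3.6, `ConnesConsaniMoscovici2025_thm_3_6_holds`)
⇒ the sign survives the limit (`stub_aeNonneg_of_L2_limit`, landed). [folklore] -/
theorem sw_exists_nonneg_isWeilGroundState {a : ℝ} (ha : 0 < a) (ha' : a ≤ 1 / 10) :
    ∃ u : ℝ → ℂ, IsWeilGroundState a u ∧ ∀ᵐ t : ℝ, (u t).im = 0 ∧ 0 ≤ (u t).re := by
  obtain ⟨g, hg, hQ⟩ := stub_coneMinimizingSeq a ha (sw_coneDense_small ha ha')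
  have hg' : ∀ n, IsWeilTest (g n) ∧ tsupport (g n) ⊆ Icc (-a) a ∧ ∫ t, ‖g n t‖ ^ 2 = (1 : ℝ) :=
    fun n => ⟨(hg n).1, (hg n).2.1, (hg n).2.2.2⟩
  obtain ⟨u, hu, φ, hφ, hconv⟩ :=
    ConnesConsaniMoscovici2025_thm_3_6_holds a ha g hg' hQ.bddAbove_range
  have hQ' : Tendsto (fun n ↦ (weilQuadratic (g (φ n))).re) atTop (𝓝 (weilGroundEnergy a)) :=
    hQ.comp hφ.tendsto_atTop
  have hmem : ∀ n, MemLp (g (φ n)) 2 := fun n => (hg' (φ n)).1.memLp_two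
  have hsign := stub_aeNonneg_of_L2_limit (fun n => g (φ n)) u hmem hu
    (fun n t => (hg (φ n)).2.2.1 t) hconv
  exact ⟨u, ⟨hu, fun n => g (φ n), fun n => hg' (φ n), hQ', hconv⟩, hsign⟩

/-- **An even, real-valued, everywhere non-negative ground state at every small window** (the
previous theorem combined with `exists_even_real_nonneg_of_oneSigned`: symmetrise and modify on a
null set). [folklore] -/
theorem sw_exists_even_real_nonneg_isWeilGroundState {a : ℝ} (ha : 0 < a) (ha' : a ≤ 1 / 10) :
    ∃ u : ℝ → ℂ, IsWeilGroundState a u ∧ (∀ t, u (-t) = u t) ∧ (∀ t, (u t).im = 0) ∧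
      ∀ t, 0 ≤ (u t).re := by
  obtain ⟨u, hu, hsign⟩ := sw_exists_nonneg_isWeilGroundState ha ha'
  exact exists_even_real_nonneg_of_oneSigned hu (hsign.mono fun t ht _ => ht)

/-- **`GSP a` in the route items' inline encoding** (the conclusion of the matrix of
`PolarPerronFrobenius` and the hypothesis of the rung `GroundBartaFloor`, at window `a`), for every
`0 < a ≤ 1/10`. [folklore] -/
theorem sw_GSP_small {a : ℝ} (ha : 0 < a) (ha' : a ≤ 1 / 10) :
    ∃ u : ℝ → ℂ, (MemLp u 2 ∧ ∃ g : ℕ → ℝ → ℂ,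
      (∀ n, IsWeilTest (g n) ∧ tsupport (g n) ⊆ Icc (-a) a ∧ ∫ t, ‖g n t‖ ^ 2 = (1 : ℝ)) ∧
      (∀ h : ℝ → ℂ, IsWeilTest h → tsupport h ⊆ Icc (-a) a → ∫ t, ‖h t‖ ^ 2 = (1 : ℝ) →
        ∀ δ : ℝ, 0 < δ → ∀ᶠ n in atTop, (weilQuadratic (g n)).re ≤ (weilQuadratic h).re + δ) ∧
      Tendsto (fun n ↦ ∫ t, ‖g n t - u t‖ ^ 2) atTop (𝓝 0)) ∧
      (∀ᵐ t : ℝ, t ∈ Ioo (-a) a → (u t).im = 0 ∧ 0 ≤ (u t).re) := by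
  obtain ⟨u, hu, hsign⟩ := sw_exists_nonneg_isWeilGroundState ha ha'
  exact ⟨u, (isWeilGroundState_iff_forall_eventually_le a u).1 hu, hsign.mono fun t ht _ => ht⟩

/-- **The matrix of the crux holds at every small window**: for `0 < a ≤ 1/10` the window-`a` clause
`EW a → GSP a` of `PolarPerronFrobenius` is true (indeed `GSP a` is, with no even-winning input).  The
crux itself asks for such windows BEYOND EVERY HEIGHT; its RH-bearing content therefore lives entirely
at large windows. [folklore] -/
theorem sw_polarMatrix_small {a : ℝ} (ha : 0 < a) (ha' : a ≤ 1 / 10) :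
    (∀ o : ℝ → ℂ, IsWeilTest o → tsupport o ⊆ Icc (-a) a → (∀ t, o (-t) = -o t) →
        ∫ t, ‖o t‖ ^ 2 = (1 : ℝ) → ∀ δ : ℝ, 0 < δ → ∃ w : ℝ → ℂ, IsWeilTest w ∧
          tsupport w ⊆ Icc (-a) a ∧ (∀ t, w (-t) = w t) ∧ ∫ t, ‖w t‖ ^ 2 = (1 : ℝ) ∧
          (weilQuadratic w).re ≤ (weilQuadratic o).re + δ) →
      ∃ u : ℝ → ℂ, (MemLp u 2 ∧ ∃ g : ℕ → ℝ → ℂ,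
        (∀ n, IsWeilTest (g n) ∧ tsupport (g n) ⊆ Icc (-a) a ∧ ∫ t, ‖g n t‖ ^ 2 = (1 : ℝ)) ∧
        (∀ h : ℝ → ℂ, IsWeilTest h → tsupport h ⊆ Icc (-a) a → ∫ t, ‖h t‖ ^ 2 = (1 : ℝ) →
          ∀ δ : ℝ, 0 < δ → ∀ᶠ n in atTop, (weilQuadratic (g n)).re ≤ (weilQuadratic h).re + δ) ∧
        Tendsto (fun n ↦ ∫ t, ‖g n t - u t‖ ^ 2) atTop (𝓝 0)) ∧
        (∀ᵐ t : ℝ, t ∈ Ioo (-a) a → (u t).im = 0 ∧ 0 ≤ (u t).re) :=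
  fun _ => sw_GSP_small ha ha'

end Summit.RiemannHypothesis.RiemannHypothesis.Theorems.PolarPerronFrobenius

end
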